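import Summits.CriticalPhenomena.PercolationContinuityZ3.Theorems.PercNearOneGluingNoHeavyLowerTailSahiGridPatternCrossedCanonicalLayer

/-!
# `NoHeavyLowerTail` (crux stmt-CriticalPhenomena-4575), Sahi programme P1: the crossed family at the canonical certificate — **the layer identity**
# (every `k`, all up-sets): what the remaining 'straddling layer' case must prove

Support file (Sahi cell, seat `prim-sahi-p1`, generation 44; `--supports stmt-CriticalPhenomena-4575`).  Pure proofs, no definitions, no `sorry`, standard axioms.
Vocabulary of `…SahiGridPatternCrossedCanonical{,Sub,Layer}` (`S = x∨y`, `A = S×V`, crossed pair `P = {x≥1}×A₀`, `Q = {q∈B′} ∪ ({y≥1}×B)`, `B′ ⊆ B`, `F = A₀∩B′`).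

THE MATHEMATICS (seat memo FROM-prim-sahi-p1-gen44 §1, §3).  Let `L := V ∩ (B ∖ B′)` (the `V`-layer between the two `y`-sections) and `B″ := B′ ∪ (B ∩ V) = B′ ⊔ L`.
With `κ′ = κ′_V(A₀,B′)`, `H = H_V`, `h = h_V` as before, `κ′_V(A₀,L) := Σ_{s∈L} K_s(A₀,V) ≥ 0` (cube Kleitman at the centres of the layer) and
`D(L) := Σ_{s∈L∩A₀} #(C_s ∖ V)` (pairs `(s,t)`, `s` an `A₀`-point of the layer, `t δ̸ s`, `t ∉ V`), the following is an IDENTITY of pair counts: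

   `[H(F) + h(B,A₀) − κ′]  =  Φ_V(A₀,B″) + κ′_V(A₀,L) − D(L)`,      `Φ_V(A₀,B″) = λ_V(A₀∩B″) − Θ_V(A₀×B″)`      (`layer_identity`).

The left side is the slack of the sharp form (CR5)/(CR7) `κ′ ≤ H(F) + h(B,A₀)` (which implies (CR′) and hence the crossed (N)); so for a good inner block `V` the
crossed pair at `(A₀,B′,B)` is settled as soon as **`D(L) ≤ Φ_V(A₀,B″) + κ′_V(A₀,L)`** (`cr_of_layer_bound` → `…_canonical_of_layer_bound`, `sStarD_…_layer_bound_nonneg`).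
This contains both layer cases of the companion file (`L ∩ A₀ = ∅`: `D = 0`; `L ⊆ A₀`: via `h(B′,A₀) ≤ h(B,A₀)`) and isolates the open 'straddling layer' case as a
QUANTITATIVE goodness statement at the `V`-dependent rectangle `(A₀, B″)`: the value of `Φ_V(A₀,B″)` (not merely its sign) must dominate `D(L) − κ′_V(A₀,L)`
(exhaustively true `k ≤ 3`, sampled `k ≤ 6`; memo §3, §7).  Nothing here asserts Conjecture A in general or `PatternPos d` for `d ≥ 4`. [this work]
-/

namespace Summit.CriticalPhenomena.PercolationContinuityZ3.Theorems.SahiGridPattern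

open Finset SahiGrid3
open scoped BigOperators

section CrossedCanonicalLayerIdentity

variable {k : ℕ} {S Fx Gy : Finset (Pd (1 + 1))} {V : Finset (Pd k)} {A : Finset (Pd ((1 + 1) + k))}

/-- **THE LAYER IDENTITY** (every `k`; `A₀, V` arbitrary finsets, `B′ ⊆ B`): with the layer indicator `ℓ(x) = 1_B(x)1_V(x)(1 − 1_{B′}(x))` and
`B″ = B′ ∪ (B∩V)`,  `[H_V(F) + h_V(B,A₀)] − κ′_V(A₀,B′) = [λ_V(A₀∩B″) − Θ_V(A₀×B″)] + κ′_V(A₀,L) − D(L)`  in indicator pair-count form. [this work] -/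
theorem layer_identity {A0 Bp B0 : Finset (Pd k)} (hsub : Bp ⊆ B0) :
    ((2:ℤ) ^ k * (∑ q : Pd k, ind A0 q * ind Bp q * ind V q)
        - (∑ q : Pd k, ∑ r : Pd k, ind A0 q * ind Bp q * (if TotDist q r = true then (1:ℤ) else 0) * ind V r))
      + ((2:ℤ) ^ k * (∑ q : Pd k, ind A0 q * ind B0 q * ind V q)
        - (∑ q : Pd k, ∑ r : Pd k, ind A0 q * ind B0 r * (if TotDist q r = true then (1:ℤ) else 0) * ind V r))
      - ((∑ q : Pd k, ∑ r : Pd k, ind A0 q * ind Bp r * (if TotDist q r = true then (1:ℤ) else 0) * ind V q)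
        - (∑ q : Pd k, ∑ r : Pd k, ind A0 q * ind Bp r * (if TotDist q r = true then (1:ℤ) else 0) * ind V (thirdPt q r)))
    = ((∑ q ∈ A0 ∩ (Bp ∪ (B0 ∩ V)), lamU V q) - (∑ q ∈ A0, ∑ r ∈ Bp ∪ (B0 ∩ V), thetaVal V q r))
      + (∑ q : Pd k, ∑ r : Pd k, ind A0 q * (ind B0 r * ind V r * (1 - ind Bp r)) * (if TotDist q r = true then (1:ℤ) else 0)
          * (ind V q - ind V (thirdPt q r)))
      - (∑ q : Pd k, ∑ r : Pd k, ind A0 q * (ind B0 q * ind V q * (1 - ind Bp q)) * (if TotDist q r = true then (1:ℤ) else 0)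
          * (1 - ind V r)) := by
  set Bs : Finset (Pd k) := Bp ∪ (B0 ∩ V) with hBs
  -- goodness slack at (A0, Bs) in pair counts
  rw [theta_rect_eq_counts V A0 Bs, sum_inter_lamU_eq V A0 Bs]
  -- pointwise identities
  have p1 : ∀ x : Pd k, ind Bs x * ind V x = ind B0 x * ind V x := by
    intro x
    by_cases hx : x ∈ V
    · by_cases hx0 : x ∈ B0
      · have hxs : x ∈ Bs := by rw [hBs]; exact Finset.mem_union_right _ (Finset.mem_inter.2 ⟨hx0, hx⟩)
        unfold ind; rw [if_pos hx, if_pos hx0, if_pos hxs]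
      · have hxs : x ∉ Bs := by
          rw [hBs, Finset.mem_union, not_or]
          exact ⟨fun h => hx0 (hsub h), fun h => hx0 (Finset.mem_inter.1 h).1⟩
        unfold ind; rw [if_pos hx, if_neg hx0, if_neg hxs]
    · unfold ind; rw [if_neg hx]; ring
  have p2 : ∀ x : Pd k, ind Bs x = ind Bp x + ind B0 x * ind V x * (1 - ind Bp x) := by
    intro x
    by_cases hxp : x ∈ Bp
    · have hxs : x ∈ Bs := by rw [hBs]; exact Finset.mem_union_left _ hxp
      unfold ind; rw [if_pos hxp, if_pos hxs]; ring
    · by_cases hx : x ∈ B0 ∧ x ∈ V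
      · have hxs : x ∈ Bs := by rw [hBs]; exact Finset.mem_union_right _ (Finset.mem_inter.2 hx)
        unfold ind; rw [if_neg hxp, if_pos hxs, if_pos hx.1, if_pos hx.2]; ring
      · have hxs : x ∉ Bs := by
          rw [hBs, Finset.mem_union, not_or]
          exact ⟨hxp, fun h => hx (Finset.mem_inter.1 h)⟩
        unfold ind; rw [if_neg hxp, if_neg hxs]
        rcases not_and_or.1 hx with h0 | hV
        · rw [if_neg h0]; ring
        · rw [if_neg hV]; ring
  have p3 : ∀ x : Pd k, ind Bp x * ind B0 x = ind Bp x := by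
    intro x
    by_cases hxp : x ∈ Bp
    · have hx0 : x ∈ B0 := hsub hxp
      unfold ind; rw [if_pos hxp, if_pos hx0]; ring
    · unfold ind; rw [if_neg hxp]; ring
  -- (a) the diagonal term: 2·2^k Σ A0 Bs V = 2·2^k Σ A0 B0 V
  have ea : (∑ q : Pd k, ind A0 q * ind Bs q * ind V q) = ∑ q : Pd k, ind A0 q * ind B0 q * ind V q := by
    refine Finset.sum_congr rfl fun q _ => ?_
    calc ind A0 q * ind Bs q * ind V q = ind A0 q * (ind Bs q * ind V q) := by ring
      _ = ind A0 q * (ind B0 q * ind V q) := by rw [p1 q]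
      _ = ind A0 q * ind B0 q * ind V q := by ring
  -- (b) N(V; A0∩Bs) = N_F + Σ A0 ℓ(q) td V r
  have eb : (∑ q : Pd k, ∑ r : Pd k, ind A0 q * ind Bs q * (if TotDist q r = true then (1:ℤ) else 0) * ind V r)
      = (∑ q : Pd k, ∑ r : Pd k, ind A0 q * ind Bp q * (if TotDist q r = true then (1:ℤ) else 0) * ind V r)
        + ∑ q : Pd k, ∑ r : Pd k, ind A0 q * (ind B0 q * ind V q * (1 - ind Bp q)) * (if TotDist q r = true then (1:ℤ) else 0) * ind V r := by
    rw [← Finset.sum_add_distrib]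
    refine Finset.sum_congr rfl fun q _ => ?_
    rw [← Finset.sum_add_distrib]
    refine Finset.sum_congr rfl fun r _ => ?_
    rw [p2 q]; ring
  -- (c) the partner count at Bs: κ⁺ + Σ A0 ℓ(r) td V q
  have ec : (∑ q : Pd k, ∑ r : Pd k, ind A0 q * ind Bs r * (if TotDist q r = true then (1:ℤ) else 0) * ind V q)
      = (∑ q : Pd k, ∑ r : Pd k, ind A0 q * ind Bp r * (if TotDist q r = true then (1:ℤ) else 0) * ind V q)
        + ∑ q : Pd k, ∑ r : Pd k, ind A0 q * (ind B0 r * ind V r * (1 - ind Bp r)) * (if TotDist q r = true then (1:ℤ) else 0) * ind V q := by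
    rw [← Finset.sum_add_distrib]
    refine Finset.sum_congr rfl fun q _ => ?_
    rw [← Finset.sum_add_distrib]
    refine Finset.sum_congr rfl fun r _ => ?_
    rw [p2 r]; ring
  -- (d) the V-partner count at Bs is the one at B0
  have ed : (∑ q : Pd k, ∑ r : Pd k, ind A0 q * ind Bs r * (if TotDist q r = true then (1:ℤ) else 0) * ind V r)
      = ∑ q : Pd k, ∑ r : Pd k, ind A0 q * ind B0 r * (if TotDist q r = true then (1:ℤ) else 0) * ind V r := by
    refine Finset.sum_congr rfl fun q _ => Finset.sum_congr rfl fun r _ => ?_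
    calc ind A0 q * ind Bs r * (if TotDist q r = true then (1:ℤ) else 0) * ind V r
        = ind A0 q * (if TotDist q r = true then (1:ℤ) else 0) * (ind Bs r * ind V r) := by ring
      _ = ind A0 q * (if TotDist q r = true then (1:ℤ) else 0) * (ind B0 r * ind V r) := by rw [p1 r]
      _ = ind A0 q * ind B0 r * (if TotDist q r = true then (1:ℤ) else 0) * ind V r := by ring
  -- (e) the Latin count at Bs: κ⁻ + Σ A0 ℓ(r) td V(third)
  have ee : (∑ q : Pd k, ∑ r : Pd k, ind A0 q * ind Bs r * (if TotDist q r = true then (1:ℤ) else 0) * ind V (thirdPt q r))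
      = (∑ q : Pd k, ∑ r : Pd k, ind A0 q * ind Bp r * (if TotDist q r = true then (1:ℤ) else 0) * ind V (thirdPt q r))
        + ∑ q : Pd k, ∑ r : Pd k, ind A0 q * (ind B0 r * ind V r * (1 - ind Bp r)) * (if TotDist q r = true then (1:ℤ) else 0)
            * ind V (thirdPt q r) := by
    rw [← Finset.sum_add_distrib]
    refine Finset.sum_congr rfl fun q _ => ?_
    rw [← Finset.sum_add_distrib]
    refine Finset.sum_congr rfl fun r _ => ?_
    rw [p2 r]; ring
  -- (f) κ′(A0,L) split into its two counts
  have ef : (∑ q : Pd k, ∑ r : Pd k, ind A0 q * (ind B0 r * ind V r * (1 - ind Bp r)) * (if TotDist q r = true then (1:ℤ) else 0)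
          * (ind V q - ind V (thirdPt q r)))
      = (∑ q : Pd k, ∑ r : Pd k, ind A0 q * (ind B0 r * ind V r * (1 - ind Bp r)) * (if TotDist q r = true then (1:ℤ) else 0) * ind V q)
        - ∑ q : Pd k, ∑ r : Pd k, ind A0 q * (ind B0 r * ind V r * (1 - ind Bp r)) * (if TotDist q r = true then (1:ℤ) else 0)
            * ind V (thirdPt q r) := by
    rw [← Finset.sum_sub_distrib]
    refine Finset.sum_congr rfl fun q _ => ?_
    rw [← Finset.sum_sub_distrib]
    refine Finset.sum_congr rfl fun r _ => ?_
    ring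
  -- (g) D(L) = 2^k Σ A0 ℓ − Σ A0 ℓ(q) td V r, and 2^k Σ A0 ℓ = T_B − T_F
  have eg : (∑ q : Pd k, ∑ r : Pd k, ind A0 q * (ind B0 q * ind V q * (1 - ind Bp q)) * (if TotDist q r = true then (1:ℤ) else 0)
          * (1 - ind V r))
      = ((2:ℤ) ^ k * (∑ q : Pd k, ind A0 q * ind B0 q * ind V q) - (2:ℤ) ^ k * (∑ q : Pd k, ind A0 q * ind Bp q * ind V q))
        - ∑ q : Pd k, ∑ r : Pd k, ind A0 q * (ind B0 q * ind V q * (1 - ind Bp q)) * (if TotDist q r = true then (1:ℤ) else 0) * ind V r := by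
    have e1 : (∑ q : Pd k, ∑ r : Pd k, ind A0 q * (ind B0 q * ind V q * (1 - ind Bp q)) * (if TotDist q r = true then (1:ℤ) else 0)
          * (1 - ind V r))
        = (∑ q : Pd k, ∑ r : Pd k, ind A0 q * (ind B0 q * ind V q * (1 - ind Bp q)) * (if TotDist q r = true then (1:ℤ) else 0))
          - ∑ q : Pd k, ∑ r : Pd k, ind A0 q * (ind B0 q * ind V q * (1 - ind Bp q)) * (if TotDist q r = true then (1:ℤ) else 0) * ind V r := by
      rw [← Finset.sum_sub_distrib]
      refine Finset.sum_congr rfl fun q _ => ?_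
      rw [← Finset.sum_sub_distrib]
      refine Finset.sum_congr rfl fun r _ => ?_
      ring
    have e2 : (∑ q : Pd k, ∑ r : Pd k, ind A0 q * (ind B0 q * ind V q * (1 - ind Bp q)) * (if TotDist q r = true then (1:ℤ) else 0))
        = (2:ℤ) ^ k * (∑ q : Pd k, ind A0 q * ind B0 q * ind V q) - (2:ℤ) ^ k * (∑ q : Pd k, ind A0 q * ind Bp q * ind V q) := by
      rw [Finset.mul_sum, Finset.mul_sum, ← Finset.sum_sub_distrib]
      refine Finset.sum_congr rfl fun q _ => ?_
      have e3 : (∑ r : Pd k, ind A0 q * (ind B0 q * ind V q * (1 - ind Bp q)) * (if TotDist q r = true then (1:ℤ) else 0))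
          = ind A0 q * (ind B0 q * ind V q * (1 - ind Bp q)) * ∑ r : Pd k, (if TotDist q r = true then (1:ℤ) else 0) := by
        rw [Finset.mul_sum]
      rw [e3, sum_ite_totDist_eq_pow_left q]
      have e4 : ind Bp q * ind V q = ind Bp q * ind B0 q * ind V q := by rw [p3 q]
      calc ind A0 q * (ind B0 q * ind V q * (1 - ind Bp q)) * (2:ℤ) ^ k
          = (2:ℤ) ^ k * (ind A0 q * ind B0 q * ind V q) - (2:ℤ) ^ k * (ind A0 q * (ind Bp q * ind B0 q * ind V q)) := by ring
        _ = (2:ℤ) ^ k * (ind A0 q * ind B0 q * ind V q) - (2:ℤ) ^ k * (ind A0 q * (ind Bp q * ind V q)) := by rw [← e4]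
        _ = (2:ℤ) ^ k * (ind A0 q * ind B0 q * ind V q) - (2:ℤ) ^ k * (ind A0 q * ind Bp q * ind V q) := by ring
    rw [e1, e2]
  rw [ea, eb, ec, ed, ee, ef, eg]
  ring

/-- **(CR5)/(CR7) from the layer bound** (every `k`, finsets `A₀, V`, `B′ ⊆ B`): if `D(L) ≤ Φ_V(A₀,B″) + κ′_V(A₀,L)` then `κ′_V(A₀,B′) ≤ H_V(F) + h_V(B,A₀)`.
[this work] -/
theorem cr5_of_layer_bound {A0 Bp B0 : Finset (Pd k)} (hsub : Bp ⊆ B0)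
    (hD : (∑ q : Pd k, ∑ r : Pd k, ind A0 q * (ind B0 q * ind V q * (1 - ind Bp q)) * (if TotDist q r = true then (1:ℤ) else 0)
          * (1 - ind V r))
      ≤ ((∑ q ∈ A0 ∩ (Bp ∪ (B0 ∩ V)), lamU V q) - (∑ q ∈ A0, ∑ r ∈ Bp ∪ (B0 ∩ V), thetaVal V q r))
        + (∑ q : Pd k, ∑ r : Pd k, ind A0 q * (ind B0 r * ind V r * (1 - ind Bp r)) * (if TotDist q r = true then (1:ℤ) else 0)
          * (ind V q - ind V (thirdPt q r)))) :
    (∑ q : Pd k, ∑ r : Pd k, ind A0 q * ind Bp r * (if TotDist q r = true then (1:ℤ) else 0) * ind V q)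
      - (∑ q : Pd k, ∑ r : Pd k, ind A0 q * ind Bp r * (if TotDist q r = true then (1:ℤ) else 0) * ind V (thirdPt q r))
      ≤ ((2:ℤ) ^ k * (∑ q : Pd k, ind A0 q * ind Bp q * ind V q)
          - (∑ q : Pd k, ∑ r : Pd k, ind A0 q * ind Bp q * (if TotDist q r = true then (1:ℤ) else 0) * ind V r))
        + ((2:ℤ) ^ k * (∑ q : Pd k, ind A0 q * ind B0 q * ind V q)
          - (∑ q : Pd k, ∑ r : Pd k, ind A0 q * ind B0 r * (if TotDist q r = true then (1:ℤ) else 0) * ind V r)) := by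
  have h := layer_identity (V := V) (A0 := A0) hsub
  linarith

/-- **(CR′) from the layer bound** (every `k`; `A₀, B, V` up-sets, `B′ ⊆ B`): the sharp form plus the two Harris slacks `H_V(F) ≥ 0`, `h_V(A₀,B) ≥ 0`.
[this work] -/
theorem cr_of_layer_bound (hV : IsUpperSet (V : Set (Pd k))) {A0 Bp B0 : Finset (Pd k)}
    (hA0 : IsUpperSet (A0 : Set (Pd k))) (hBp : IsUpperSet (Bp : Set (Pd k))) (hB0 : IsUpperSet (B0 : Set (Pd k)))
    (hsub : Bp ⊆ B0)
    (hD : (∑ q : Pd k, ∑ r : Pd k, ind A0 q * (ind B0 q * ind V q * (1 - ind Bp q)) * (if TotDist q r = true then (1:ℤ) else 0)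
          * (1 - ind V r))
      ≤ ((∑ q ∈ A0 ∩ (Bp ∪ (B0 ∩ V)), lamU V q) - (∑ q ∈ A0, ∑ r ∈ Bp ∪ (B0 ∩ V), thetaVal V q r))
        + (∑ q : Pd k, ∑ r : Pd k, ind A0 q * (ind B0 r * ind V r * (1 - ind Bp r)) * (if TotDist q r = true then (1:ℤ) else 0)
          * (ind V q - ind V (thirdPt q r)))) :
    (∑ q : Pd k, ∑ r : Pd k, ind A0 q * ind Bp r * (if TotDist q r = true then (1:ℤ) else 0) * ind V q)
      - (∑ q : Pd k, ∑ r : Pd k, ind A0 q * ind Bp r * (if TotDist q r = true then (1:ℤ) else 0) * ind V (thirdPt q r))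
      ≤ 2 * ((2:ℤ) ^ k * (∑ q : Pd k, ind A0 q * ind Bp q * ind V q)
              - ∑ q : Pd k, ∑ r : Pd k, ind A0 q * ind Bp q * (if TotDist q r = true then (1:ℤ) else 0) * ind V r)
        + ((2:ℤ) ^ k * (∑ q : Pd k, ind A0 q * ind B0 q * ind V q) - (∑ q : Pd k, ∑ r : Pd k, ind A0 q * ind B0 r * (if TotDist q r = true then (1:ℤ) else 0) * ind V q))
        + ((2:ℤ) ^ k * (∑ q : Pd k, ind A0 q * ind B0 q * ind V q) - (∑ q : Pd k, ∑ r : Pd k, ind A0 q * ind B0 r * (if TotDist q r = true then (1:ℤ) else 0) * ind V r)) := by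
  have h5 := cr5_of_layer_bound (V := V) hsub hD
  have hH : (∑ q : Pd k, ∑ r : Pd k, ind A0 q * ind Bp q * (if TotDist q r = true then (1:ℤ) else 0) * ind V r)
      ≤ (2:ℤ) ^ k * (∑ q : Pd k, ind A0 q * ind Bp q * ind V q) := by
    have h := pairCount_le_harris' (X := A0 ∩ Bp) (Y := (univ : Finset (Pd k))) hV (isUpperSet_inter_coe hA0 hBp)
      (by rw [Finset.coe_univ]; exact isUpperSet_univ)
    have f1 : (∑ q : Pd k, ∑ r : Pd k, ind (A0 ∩ Bp) q * ind (univ : Finset (Pd k)) r * (if TotDist q r = true then (1:ℤ) else 0) * ind V r)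
        = ∑ q : Pd k, ∑ r : Pd k, ind A0 q * ind Bp q * (if TotDist q r = true then (1:ℤ) else 0) * ind V r := by
      refine Finset.sum_congr rfl fun q _ => Finset.sum_congr rfl fun r _ => ?_
      rw [ind_inter_eq_mul, ind_univ_eq_one]; ring
    have f2 : (∑ q : Pd k, ind (A0 ∩ Bp) q * ind (univ : Finset (Pd k)) q * ind V q) = ∑ q : Pd k, ind A0 q * ind Bp q * ind V q := by
      refine Finset.sum_congr rfl fun q _ => ?_
      rw [ind_inter_eq_mul, ind_univ_eq_one]; ring
    rw [f1, f2] at h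
    exact h
  have hH1 : (∑ q : Pd k, ∑ r : Pd k, ind A0 q * ind B0 r * (if TotDist q r = true then (1:ℤ) else 0) * ind V q)
      ≤ (2:ℤ) ^ k * (∑ q : Pd k, ind A0 q * ind B0 q * ind V q) := pairCount_le_harris hV hA0 hB0
  linarith

/-- **The crossed (N) at the canonical certificate from the layer bound** (every `k`, every up-set `V` good at `(A₀,B)` and `(A₀,B′)`). [this work] -/
theorem diagCert_coProduct_N_orTwo_crossed_canonical_of_layer_bound (hS : ∀ ξ η : Pd 1, glue ξ η ∈ S ↔ (1 ≤ ξ 0 ∨ 1 ≤ η 0))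
    (hFx : ∀ ξ η : Pd 1, glue ξ η ∈ Fx ↔ 1 ≤ ξ 0) (hGy : ∀ ξ η : Pd 1, glue ξ η ∈ Gy ↔ 1 ≤ η 0)
    (hV : IsUpperSet (V : Set (Pd k))) (hA : ∀ σ z, glue σ z ∈ A ↔ (σ ∈ S ∧ z ∈ V))
    (dS : Pd (1 + 1) → ℤ) (hdS : dS (glue (fun _ => 0) (fun _ => 0)) = 0 ∧ dS (glue (fun _ => 0) (fun _ => 1)) = 4 ∧ dS (glue (fun _ => 0) (fun _ => 2)) = 4 ∧
      dS (glue (fun _ => 1) (fun _ => 0)) = 2 ∧ dS (glue (fun _ => 1) (fun _ => 1)) = 5 ∧ dS (glue (fun _ => 1) (fun _ => 2)) = 5 ∧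
      dS (glue (fun _ => 2) (fun _ => 0)) = 2 ∧ dS (glue (fun _ => 2) (fun _ => 1)) = 5 ∧ dS (glue (fun _ => 2) (fun _ => 2)) = 5)
    {A0 Bp B0 : Finset (Pd k)} (hA0 : IsUpperSet (A0 : Set (Pd k))) (hBp : IsUpperSet (Bp : Set (Pd k))) (hB0 : IsUpperSet (B0 : Set (Pd k)))
    (hsub : Bp ⊆ B0)
    (hGB : (∑ q ∈ A0, ∑ r ∈ B0, thetaVal V q r) ≤ ∑ q ∈ A0 ∩ B0, lamU V q)
    (hGBp : (∑ q ∈ A0, ∑ r ∈ Bp, thetaVal V q r) ≤ ∑ q ∈ A0 ∩ Bp, lamU V q)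
    (hD : (∑ q : Pd k, ∑ r : Pd k, ind A0 q * (ind B0 q * ind V q * (1 - ind Bp q)) * (if TotDist q r = true then (1:ℤ) else 0)
          * (1 - ind V r))
      ≤ ((∑ q ∈ A0 ∩ (Bp ∪ (B0 ∩ V)), lamU V q) - (∑ q ∈ A0, ∑ r ∈ Bp ∪ (B0 ∩ V), thetaVal V q r))
        + (∑ q : Pd k, ∑ r : Pd k, ind A0 q * (ind B0 r * ind V r * (1 - ind Bp r)) * (if TotDist q r = true then (1:ℤ) else 0)
          * (ind V q - ind V (thirdPt q r))))
    {P Q : Finset (Pd ((1 + 1) + k))} (hP : ∀ σ q, glue σ q ∈ P ↔ (σ ∈ Fx ∧ q ∈ A0)) (hQ : ∀ σ q, glue σ q ∈ Q ↔ (q ∈ Bp ∨ (σ ∈ Gy ∧ q ∈ B0))) :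
    (∑ x ∈ P, ∑ y ∈ Q, thetaVal A x y) ≤ ∑ x ∈ P ∩ Q, (2 * (2:ℤ) ^ ((1 + 1) + k) * (ind S (freeOf x) * ind V (cellOf x))
        - (2 * (2:ℤ) ^ (1 + 1) * ind S (freeOf x) - dS (freeOf x)) * (2 * (2:ℤ) ^ k * ind V (cellOf x) - lamU V (cellOf x))) :=
  diagCert_coProduct_N_orTwo_crossed_canonical hS hFx hGy hA dS hdS hsub hGB hGBp (cr_of_layer_bound hV hA0 hBp hB0 hsub hD) hP hQ

/-- **The pattern functional from the layer bound** (with (T) and the box for `dS`): `0 ≤ sStarD ((x∨y)×V) P Q` at the crossed pair whenever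
`D(L) ≤ Φ_V(A₀,B″) + κ′_V(A₀,L)`, for every up-set `V` good at `(A₀,B)`, `(A₀,B′)` — every `k`. [this work] -/
theorem sStarD_blockAnd_orTwo_crossed_layer_bound_nonneg (hS : ∀ ξ η : Pd 1, glue ξ η ∈ S ↔ (1 ≤ ξ 0 ∨ 1 ≤ η 0))
    (hFx : ∀ ξ η : Pd 1, glue ξ η ∈ Fx ↔ 1 ≤ ξ 0) (hGy : ∀ ξ η : Pd 1, glue ξ η ∈ Gy ↔ 1 ≤ η 0)
    (hV : IsUpperSet (V : Set (Pd k))) (hA : ∀ σ z, glue σ z ∈ A ↔ (σ ∈ S ∧ z ∈ V))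
    (dS : Pd (1 + 1) → ℤ) (hdS : dS (glue (fun _ => 0) (fun _ => 0)) = 0 ∧ dS (glue (fun _ => 0) (fun _ => 1)) = 4 ∧ dS (glue (fun _ => 0) (fun _ => 2)) = 4 ∧
      dS (glue (fun _ => 1) (fun _ => 0)) = 2 ∧ dS (glue (fun _ => 1) (fun _ => 1)) = 5 ∧ dS (glue (fun _ => 1) (fun _ => 2)) = 5 ∧
      dS (glue (fun _ => 2) (fun _ => 0)) = 2 ∧ dS (glue (fun _ => 2) (fun _ => 1)) = 5 ∧ dS (glue (fun _ => 2) (fun _ => 2)) = 5)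
    (hTS : ∀ W : Finset (Pd (1 + 1)), IsUpperSet (W : Set (Pd (1 + 1))) → (∑ ξ ∈ W, dS ξ) ≤ ∑ ξ ∈ W, lamU S ξ)
    (hmS : ∀ ξ : Pd (1 + 1), dS ξ ≤ 2 * (2:ℤ) ^ (1 + 1) * ind S ξ)
    {A0 Bp B0 : Finset (Pd k)} (hA0 : IsUpperSet (A0 : Set (Pd k))) (hBp : IsUpperSet (Bp : Set (Pd k))) (hB0 : IsUpperSet (B0 : Set (Pd k)))
    (hsub : Bp ⊆ B0)
    (hGB : (∑ q ∈ A0, ∑ r ∈ B0, thetaVal V q r) ≤ ∑ q ∈ A0 ∩ B0, lamU V q)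
    (hGBp : (∑ q ∈ A0, ∑ r ∈ Bp, thetaVal V q r) ≤ ∑ q ∈ A0 ∩ Bp, lamU V q)
    (hD : (∑ q : Pd k, ∑ r : Pd k, ind A0 q * (ind B0 q * ind V q * (1 - ind Bp q)) * (if TotDist q r = true then (1:ℤ) else 0)
          * (1 - ind V r))
      ≤ ((∑ q ∈ A0 ∩ (Bp ∪ (B0 ∩ V)), lamU V q) - (∑ q ∈ A0, ∑ r ∈ Bp ∪ (B0 ∩ V), thetaVal V q r))
        + (∑ q : Pd k, ∑ r : Pd k, ind A0 q * (ind B0 r * ind V r * (1 - ind Bp r)) * (if TotDist q r = true then (1:ℤ) else 0)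
          * (ind V q - ind V (thirdPt q r))))
    {P Q : Finset (Pd ((1 + 1) + k))} (hPu : IsUpperSet (P : Set (Pd ((1 + 1) + k)))) (hQu : IsUpperSet (Q : Set (Pd ((1 + 1) + k))))
    (hP : ∀ σ q, glue σ q ∈ P ↔ (σ ∈ Fx ∧ q ∈ A0)) (hQ : ∀ σ q, glue σ q ∈ Q ↔ (q ∈ Bp ∨ (σ ∈ Gy ∧ q ∈ B0))) :
    0 ≤ sStarD A P Q := by
  rw [sStarD_eq_sum_lamU_sub_sum_thetaVal]
  have hTV : ∀ W : Finset (Pd k), IsUpperSet (W : Set (Pd k)) → (∑ q ∈ W, lamU V q) ≤ ∑ q ∈ W, lamU V q := fun W _ => le_rfl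
  have hT := diagCert_coProduct_T hA dS (lamU V) hTS hTV hmS (isUpperSet_inter_coe hPu hQu)
  have hN := diagCert_coProduct_N_orTwo_crossed_canonical_of_layer_bound hS hFx hGy hV hA dS hdS hA0 hBp hB0 hsub hGB hGBp hD hP hQ
  linarith

end CrossedCanonicalLayerIdentity

end Summit.CriticalPhenomena.PercolationContinuityZ3.Theorems.SahiGridPattern
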